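import Summits.ResolutionOfSingularities.ResolutionOfSingularities.Theorems.PlanarCurveTrapQPow2
import HarnessLib

/-!
# PlanarCurveTrapForms — decomp-res node «CurveTrap» (lens-5 g26, critic row 177 CLEARED DECIDED +1), tree file 3/7 of the node

Content VERBATIM from the decomp-res lens-5 g26 node `HOME/decomp-res-lens-5/g26/CurveTrap.lean` (pin 39d382f9;
imports the landed tree only, carries nothing);
HOME = run/shared/lean/pub/decomp-res; critic row 177 CLEARED DECIDED +1; landing orders NODE §8 / INBOX :842 —
provenance, critic text and the lens header in full in the first
file of the node, `PlanarCurveTrapQPow`.  Namespace `…Theorems.CurveTrap`; `--supports stmt-ResolutionOfSingularities-31770`.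

## This file

§G THE CURVE FORM `X_m^b · W^a · U + S_q` (the TRAP datum) — `section Trap`: `InCurveForm q G m n a b` / `InEndForm
q G β` (untagged `def : Prop`), the ORDER LAW `coeff_ne_zero_of_inCurveForm` (`X_m^b X_n^a ∈ supp G`), the STEP LAWS
= THE CLOCK `step_chart_monomial` (chart `m`, `q ≤ a+b` ⇒ curve form `(m,n,a,a+b−q)` or end form) and
`step_chart_curve` (chart `n` ⇒ curve form `(n,m,a,a+b−q)` — letters swapped — or end form), END FORM ⇒ the `h = 0`
MONOMIAL CASE after cleaning (`isMonomialCase_cleanSeries_of_inEndForm`), `InCurveForm.of_cleanSeries`.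

[WRITER NOTE (decomp-res writer g11): file split only (tree files ≤ 400 lines); namespace, sections, section
variables, the `open` block and every
declaration exactly as in the lens (the node's global dupNamespace-linter line is dropped — the library sets it);
ONE deletion (gate dedup
rule, critic :842 watch-list): the node's copy `eq_single_add_single_two` is NOT re-landed — it is LITERALLY the landed
`HauserPerlega2024.finsupp_eq_single_add_single` (`PointBlowupFlagTranslatedStep`, imported; namespace opened as in
the lens), cited by name at its two uses; no instance, no notation, no include/omit added.]

(Sources: HauserPerlega2024 (characteristic-free resolution of surfaces by point blowups: Props. 3–4, the monomial
case); Hauser2010 Lectures VII–IX; CossartJannsenSaito2020 Ch. 5; Moh1987; BenitoVillamayor2014; the Hasse–Schmidt /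
point-blowup flag formalism of the tree (Literature PointBlowupFlag*).)
-/

open MvPolynomial Finset
open Literature.AlgebraicGeometry.Resolution
open Literature.AlgebraicGeometry.Resolution.Hauser2010
open Literature.AlgebraicGeometry.Resolution.HauserPerlega2024
open Literature.AlgebraicGeometry.Resolution.PointBlowup
open Literature.AlgebraicGeometry.Resolution.WeightedBlowup
open Summit.ResolutionOfSingularities.ResolutionOfSingularities.Theses
open Summit.ResolutionOfSingularities.ResolutionOfSingularities.Theorems.TightDefectClasses
open Summit.ResolutionOfSingularities.ResolutionOfSingularities.Theorems.TightDefectStrongWalks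
open Summit.ResolutionOfSingularities.ResolutionOfSingularities.Theorems.ItineraryCutClasses
open Summit.ResolutionOfSingularities.ResolutionOfSingularities.Theorems.ProximityCut
open Summit.ResolutionOfSingularities.ResolutionOfSingularities.Theorems.ExitLaw
open Summit.ResolutionOfSingularities.ResolutionOfSingularities.Theorems.PlanarCut
open Summit.ResolutionOfSingularities.ResolutionOfSingularities.Theorems.CoefficientCut
open Summit.ResolutionOfSingularities.ResolutionOfSingularities.Theorems.PlanarPort
open Summit.ResolutionOfSingularities.ResolutionOfSingularities.Theorems.SectionLift

namespace Summit.ResolutionOfSingularities.ResolutionOfSingularities.Theorems.CurveTrap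

section Trap

variable {σ : Type*} [DecidableEq σ] {L : Type*} [Field L]

/-! ## §G The CURVE FORM `X_m^b · W^a · U + S_q` (the TRAP datum): ORDER LAW and STEP LAW

`W` is a formal curve through the origin, REGULAR IN THE OTHER LETTER `n` (`[X_n] W ≠ 0`) — no Weierstrass
normalisation is ever made; `U` is a unit; the `S_q`-part absorbs the cleaning and the change of parameters. -/

/-- CURVE FORM (TRAP datum) `G = X_m^b · W^a · U + Q`: `U(0) ≠ 0`, `W(0) = 0`, `[X_n] W ≠ 0`, `Q ∈ S_q`.  DEFINITION. -/
def InCurveForm (q : ℕ) (G : MvPowerSeries σ L) (m n : σ) (a b : ℕ) : Prop :=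
  ∃ W U Q : MvPowerSeries σ L, G = MvPowerSeries.X m ^ b * W ^ a * U + Q ∧
    MvPowerSeries.constantCoeff U ≠ 0 ∧ MvPowerSeries.constantCoeff W = 0 ∧
    MvPowerSeries.coeff (Finsupp.single n 1) W ≠ 0 ∧ IsQPow q Q

/-- END FORM `G = X^β · V + Q`: `V(0) ≠ 0`, `Q ∈ S_q` (a monomial times a unit, up to `S_q`).  DEFINITION. -/
def InEndForm (q : ℕ) (G : MvPowerSeries σ L) (β : σ →₀ ℕ) : Prop :=
  ∃ V Q : MvPowerSeries σ L, G = MvPowerSeries.monomial β 1 * V + Q ∧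
    MvPowerSeries.constantCoeff V ≠ 0 ∧ IsQPow q Q

omit [DecidableEq σ] in
/-- `uᵃ − vᵃ = (u − v)·C`. [folklore] -/
theorem exists_pow_sub_pow (u v : MvPowerSeries σ L) (a : ℕ) : ∃ C : MvPowerSeries σ L, u ^ a = v ^ a + (u - v) * C := by
  obtain ⟨C, hC⟩ := sub_dvd_pow_sub_pow u v a
  exact ⟨C, by rw [← hC]; ring⟩

omit [DecidableEq σ] in
/-- [folklore] -/
theorem coeff_X_pow_mul_of_lt {m : σ} {k : ℕ} {d : σ →₀ ℕ} (hd : d m < k) (R : MvPowerSeries σ L) :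
    MvPowerSeries.coeff d (MvPowerSeries.X m ^ k * R) = 0 := by
  classical
  rw [MvPowerSeries.X_pow_eq, MvPowerSeries.coeff_monomial_mul, if_neg]
  intro h
  have := h m
  rw [Finsupp.single_eq_same] at this
  omega

/-- **ORDER LAW.** In curve form with `1 ≤ a < q` the monomial `X_m^b X_n^a` is present in `G` (coefficient
`([X_n] W)^a · U(0)`; the `S_q`-part cannot touch it since `q ∤ a`). [new] [folklore] -/
theorem coeff_ne_zero_of_inCurveForm {q : ℕ} {G : MvPowerSeries σ L} {m n : σ} (hmn : m ≠ n)
    (hσ : ∀ l, l = m ∨ l = n) {a b : ℕ} (ha1 : 1 ≤ a) (haq : a < q) (h : InCurveForm q G m n a b) :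
    MvPowerSeries.coeff (Finsupp.single m b + Finsupp.single n a) G ≠ 0 := by
  classical
  obtain ⟨W, U, Q, hG, hU, hW0, hWn, hQ⟩ := h
  obtain ⟨A, B, hAB, -, hB⟩ := exists_eq_X_mul_add_X_mul hmn hσ hW0
  obtain ⟨C, hC⟩ := exists_pow_sub_pow W (MvPowerSeries.X n * B) a
  have hWsub : W - MvPowerSeries.X n * B = MvPowerSeries.X m * A := by rw [hAB]; ring
  rw [hWsub] at hC
  have hmono : MvPowerSeries.monomial (Finsupp.single m b + Finsupp.single n a) (1 : L) =
      MvPowerSeries.X m ^ b * MvPowerSeries.X n ^ a := by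
    rw [MvPowerSeries.X_pow_eq, MvPowerSeries.X_pow_eq, MvPowerSeries.monomial_mul_monomial, one_mul]
  have hG' : G = MvPowerSeries.monomial (Finsupp.single m b + Finsupp.single n a) 1 * (B ^ a * U) +
      MvPowerSeries.X m ^ (b + 1) * (A * C * U) + Q := by
    rw [hmono, hG, hC]
    ring
  rw [hG', map_add, map_add, MvPowerSeries.coeff_monomial_mul, if_pos le_rfl, tsub_self, one_mul,
    coeff_X_pow_mul_of_lt (by
      rw [Finsupp.add_apply, Finsupp.single_eq_same, Finsupp.single_apply, if_neg (Ne.symm hmn)]; omega),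
    add_zero, hQ.coeff_eq_zero (d := Finsupp.single m b + Finsupp.single n a) (i := n) (by
      rw [Finsupp.add_apply, Finsupp.single_eq_same, Finsupp.single_apply, if_neg hmn, zero_add]
      exact Nat.not_dvd_of_pos_of_lt ha1 haq), add_zero,
    MvPowerSeries.coeff_zero_eq_constantCoeff_apply, map_mul, map_pow]
  exact mul_ne_zero (pow_ne_zero _ (by rw [hB]; exact hWn)) hU

/-- [folklore] -/
theorem isQPow_single (q : ℕ) (m : σ) : ∀ i, q ∣ Finsupp.single m q i := by
  intro i
  rw [Finsupp.single_apply]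
  split_ifs
  · exact dvd_rfl
  · exact dvd_zero q

variable [Fintype σ] (p : ℕ) [Fact p.Prime] [CharP L p]

/-- **STEP LAW, chart = the monomial letter `m`.**  `X_m^q · F' = Ψ_{m,t}(G)`: either the curve passes through the
point (`[X_m]W + t[X_n]W = 0`) and `F'` is in curve form with `b' = a + b − q` (same letters), or it does not and
`F'` is in end form with `β = (a+b−q)·e_m`. [new] [folklore] -/
theorem step_chart_monomial (e : ℕ) {G PT : MvPowerSeries σ L} {m n : σ} (hmn : m ≠ n) (hσ : ∀ l, l = m ∨ l = n)
    {a b : ℕ} (hab : p ^ e ≤ a + b) (h : InCurveForm (p ^ e) G m n a b) (t : L)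
    (hPT : MvPowerSeries.X m ^ p ^ e * PT = MvPowerSeries.subst (moveMap m n t) G) :
    InCurveForm (p ^ e) PT m n a (a + b - p ^ e) ∨ InEndForm (p ^ e) PT (Finsupp.single m (a + b - p ^ e)) := by
  classical
  have ha := hasSubst_moveMap (L := L) m n t
  obtain ⟨W, U, Q, hG, hU, hW0, hWn, hQ⟩ := h
  obtain ⟨A, B, hAB, -, hB⟩ := exists_eq_X_mul_add_X_mul hmn hσ hW0
  set Ψ := MvPowerSeries.substAlgHom (R := L) ha with hΨ
  have hΨe : ∀ S, MvPowerSeries.subst (moveMap m n t) S = Ψ S := fun S => by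
    rw [hΨ, MvPowerSeries.coe_substAlgHom ha]
  set W' := Ψ A + (MvPowerSeries.X n + MvPowerSeries.C t) * Ψ B with hW'
  have hΨW : Ψ W = MvPowerSeries.X m * W' := by
    rw [hAB, map_add, map_mul, map_mul, ← hΨe (MvPowerSeries.X m), subst_moveMap_X_self hmn,
      ← hΨe (MvPowerSeries.X n), subst_moveMap_X_other, hW']
    ring
  set R := W' ^ a * Ψ U with hR
  set b' := a + b - p ^ e with hb'
  set Q₁ := PT - MvPowerSeries.X m ^ b' * R with hQ₁
  have hPT' : PT = MvPowerSeries.X m ^ b' * W' ^ a * Ψ U + Q₁ := by rw [hQ₁, hR]; ring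
  have hXQ : MvPowerSeries.X m ^ p ^ e * Q₁ = Ψ Q := by
    have h1 : MvPowerSeries.X m ^ p ^ e * PT = Ψ (MvPowerSeries.X m ^ b * W ^ a * U) + Ψ Q := by
      rw [hPT, hΨe, hG, map_add]
    rw [map_mul, map_mul, map_pow, map_pow, ← hΨe (MvPowerSeries.X m), subst_moveMap_X_self hmn, hΨW] at h1
    have hbb : b + a = p ^ e + b' := by omega
    have hpow : (MvPowerSeries.X m : MvPowerSeries σ L) ^ b * (MvPowerSeries.X m * W') ^ a =
        MvPowerSeries.X m ^ p ^ e * MvPowerSeries.X m ^ b' * W' ^ a := by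
      calc (MvPowerSeries.X m : MvPowerSeries σ L) ^ b * (MvPowerSeries.X m * W') ^ a
          = MvPowerSeries.X m ^ (b + a) * W' ^ a := by ring
        _ = MvPowerSeries.X m ^ p ^ e * MvPowerSeries.X m ^ b' * W' ^ a := by rw [hbb, pow_add]
    rw [hQ₁, mul_sub, h1, hpow, hR]
    ring
  have hQ₁q : IsQPow (p ^ e) Q₁ := by
    refine IsQPow.of_monomial_mul (isQPow_single (p ^ e) m) ?_
    rw [← MvPowerSeries.X_pow_eq, hXQ, ← hΨe]
    exact hQ.subst p ha e
  have hU' : MvPowerSeries.constantCoeff (Ψ U) ≠ 0 := by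
    rw [← hΨe, constantCoeff_subst_moveMap hmn hσ]; exact hU
  have hW'n : MvPowerSeries.coeff (Finsupp.single n 1) W' ≠ 0 := by
    rw [hW', map_add, ← hΨe A, coeff_single_subst_moveMap hmn hσ, zero_add, add_mul, map_add,
      MvPowerSeries.X, MvPowerSeries.coeff_monomial_mul, if_pos le_rfl, tsub_self, one_mul,
      MvPowerSeries.coeff_C_mul, ← hΨe B, coeff_single_subst_moveMap hmn hσ, mul_zero, add_zero,
      MvPowerSeries.coeff_zero_eq_constantCoeff_apply, constantCoeff_subst_moveMap hmn hσ, hB]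
    exact hWn
  by_cases hW'0 : MvPowerSeries.constantCoeff W' = 0
  · left
    exact ⟨W', Ψ U, Q₁, hPT', hU', hW'0, hW'n, hQ₁q⟩
  · right
    refine ⟨W' ^ a * Ψ U, Q₁, ?_, ?_, hQ₁q⟩
    · rw [hPT', ← MvPowerSeries.X_pow_eq]; ring
    · rw [map_mul, map_pow]
      exact mul_ne_zero (pow_ne_zero _ hW'0) hU'

/-- **STEP LAW, chart = the curve letter `n`.**  `X_n^q · F' = Ψ_{n,t}(G)`: either the curve passes through the point
(then `t ≠ 0`, and `F'` is in curve form with the letters SWAPPED, `b' = a + b − q`), or `F'` is in end form with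
`β_n = a + b − q`. [new] [folklore] -/
theorem step_chart_curve (e : ℕ) {G PT : MvPowerSeries σ L} {m n : σ} (hmn : m ≠ n) (hσ : ∀ l, l = m ∨ l = n)
    {a b : ℕ} (hab : p ^ e ≤ a + b) (h : InCurveForm (p ^ e) G m n a b) (t : L)
    (hPT : MvPowerSeries.X n ^ p ^ e * PT = MvPowerSeries.subst (moveMap n m t) G) :
    InCurveForm (p ^ e) PT n m a (a + b - p ^ e) ∨
      ∃ β : σ →₀ ℕ, β n = a + b - p ^ e ∧ InEndForm (p ^ e) PT β := by
  classical
  have hσ' : ∀ l, l = n ∨ l = m := fun l => (hσ l).symm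
  have ha := hasSubst_moveMap (L := L) n m t
  obtain ⟨W, U, Q, hG, hU, hW0, hWn, hQ⟩ := h
  obtain ⟨A, B, hAB, hA, hB⟩ := exists_eq_X_mul_add_X_mul (Ne.symm hmn) hσ' hW0
  set Ψ := MvPowerSeries.substAlgHom (R := L) ha with hΨ
  have hΨe : ∀ S, MvPowerSeries.subst (moveMap n m t) S = Ψ S := fun S => by
    rw [hΨ, MvPowerSeries.coe_substAlgHom ha]
  set W' := Ψ A + (MvPowerSeries.X m + MvPowerSeries.C t) * Ψ B with hW'
  have hct : MvPowerSeries.constantCoeff (MvPowerSeries.X m + MvPowerSeries.C t : MvPowerSeries σ L) = t := by simp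
  have hΨW : Ψ W = MvPowerSeries.X n * W' := by
    rw [hAB, map_add, map_mul, map_mul, ← hΨe (MvPowerSeries.X n), subst_moveMap_X_self (Ne.symm hmn),
      ← hΨe (MvPowerSeries.X m), subst_moveMap_X_other, hW']
    ring
  set R := (MvPowerSeries.X m + MvPowerSeries.C t) ^ b * W' ^ a * Ψ U with hR
  set b' := a + b - p ^ e with hb'
  set Q₁ := PT - MvPowerSeries.X n ^ b' * R with hQ₁
  have hPT' : PT = MvPowerSeries.X n ^ b' * W' ^ a * ((MvPowerSeries.X m + MvPowerSeries.C t) ^ b * Ψ U) + Q₁ := by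
    rw [hQ₁, hR]; ring
  have hXQ : MvPowerSeries.X n ^ p ^ e * Q₁ = Ψ Q := by
    have h1 : MvPowerSeries.X n ^ p ^ e * PT = Ψ (MvPowerSeries.X m ^ b * W ^ a * U) + Ψ Q := by
      rw [hPT, hΨe, hG, map_add]
    rw [map_mul, map_mul, map_pow, map_pow, ← hΨe (MvPowerSeries.X m), subst_moveMap_X_other, hΨW] at h1
    have hbb : b + a = p ^ e + b' := by omega
    have hpow : (MvPowerSeries.X n * (MvPowerSeries.X m + MvPowerSeries.C t) : MvPowerSeries σ L) ^ b *
        (MvPowerSeries.X n * W') ^ a =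
        MvPowerSeries.X n ^ p ^ e * MvPowerSeries.X n ^ b' * ((MvPowerSeries.X m + MvPowerSeries.C t) ^ b * W' ^ a) := by
      calc (MvPowerSeries.X n * (MvPowerSeries.X m + MvPowerSeries.C t) : MvPowerSeries σ L) ^ b *
            (MvPowerSeries.X n * W') ^ a
          = MvPowerSeries.X n ^ (b + a) * ((MvPowerSeries.X m + MvPowerSeries.C t) ^ b * W' ^ a) := by
            rw [mul_pow, mul_pow, pow_add]; ring
        _ = _ := by rw [hbb, pow_add]
    rw [hQ₁, mul_sub, h1, hpow, hR]
    ring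
  have hQ₁q : IsQPow (p ^ e) Q₁ := by
    refine IsQPow.of_monomial_mul (isQPow_single (p ^ e) n) ?_
    rw [← MvPowerSeries.X_pow_eq, hXQ, ← hΨe]
    exact hQ.subst p ha e
  have hU' : MvPowerSeries.constantCoeff (Ψ U) ≠ 0 := by
    rw [← hΨe, constantCoeff_subst_moveMap (Ne.symm hmn) hσ']; exact hU
  have hW'0 : MvPowerSeries.constantCoeff W' = MvPowerSeries.constantCoeff A + t * MvPowerSeries.constantCoeff B := by
    rw [hW', map_add, map_mul, hct, ← hΨe A, ← hΨe B, constantCoeff_subst_moveMap (Ne.symm hmn) hσ',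
      constantCoeff_subst_moveMap (Ne.symm hmn) hσ']
  have hW'm : MvPowerSeries.coeff (Finsupp.single m 1) W' = MvPowerSeries.constantCoeff B := by
    rw [hW', map_add, ← hΨe A, coeff_single_subst_moveMap (Ne.symm hmn) hσ', zero_add, add_mul, map_add,
      MvPowerSeries.X, MvPowerSeries.coeff_monomial_mul, if_pos le_rfl, tsub_self, one_mul,
      MvPowerSeries.coeff_C_mul, ← hΨe B, coeff_single_subst_moveMap (Ne.symm hmn) hσ', mul_zero, add_zero,
      MvPowerSeries.coeff_zero_eq_constantCoeff_apply, constantCoeff_subst_moveMap (Ne.symm hmn) hσ']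
  by_cases hz : MvPowerSeries.constantCoeff W' = 0
  · -- the curve passes through the point: `t ≠ 0` and `[X_m] W ≠ 0`
    left
    have hA0 : MvPowerSeries.constantCoeff A ≠ 0 := by rw [hA]; exact hWn
    have ht : t ≠ 0 := by
      rintro rfl
      rw [hW'0, zero_mul, add_zero] at hz
      exact hA0 hz
    have hB0 : MvPowerSeries.constantCoeff B ≠ 0 := by
      intro hB0
      rw [hW'0, hB0, mul_zero, add_zero] at hz
      exact hA0 hz
    refine ⟨W', (MvPowerSeries.X m + MvPowerSeries.C t) ^ b * Ψ U, Q₁, hPT', ?_, hz, ?_, hQ₁q⟩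
    · rw [map_mul, map_pow, hct]
      exact mul_ne_zero (pow_ne_zero _ ht) hU'
    · rw [hW'm]; exact hB0
  · right
    by_cases ht : t = 0
    · have hmono : MvPowerSeries.monomial (Finsupp.single n b' + Finsupp.single m b) (1 : L) =
          MvPowerSeries.X n ^ b' * MvPowerSeries.X m ^ b := by
        rw [MvPowerSeries.X_pow_eq, MvPowerSeries.X_pow_eq, MvPowerSeries.monomial_mul_monomial, one_mul]
      refine ⟨Finsupp.single n b' + Finsupp.single m b, ?_, W' ^ a * Ψ U, Q₁, ?_, ?_, hQ₁q⟩
      · rw [Finsupp.add_apply, Finsupp.single_eq_same, Finsupp.single_apply, if_neg hmn, add_zero]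
      · rw [hmono, hPT', ht, map_zero, add_zero]
        ring
      · rw [map_mul, map_pow]
        exact mul_ne_zero (pow_ne_zero _ hz) hU'
    · refine ⟨Finsupp.single n b', Finsupp.single_eq_same, W' ^ a * ((MvPowerSeries.X m + MvPowerSeries.C t) ^ b * Ψ U),
        Q₁, ?_, ?_, hQ₁q⟩
      · rw [hPT', ← MvPowerSeries.X_pow_eq]; ring
      · rw [map_mul, map_pow, map_mul, map_pow, hct]
        exact mul_ne_zero (pow_ne_zero _ hz) (mul_ne_zero (pow_ne_zero _ ht) hU')

omit [DecidableEq σ] [Fintype σ] [Fact p.Prime] [CharP L p] in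
/-- [folklore] -/
theorem coeff_divMonomial_eq (m d : σ →₀ ℕ) (H : MvPowerSeries σ L) :
    MvPowerSeries.coeff d (divMonomial m H) = MvPowerSeries.coeff (d + m) H := rfl

omit [DecidableEq σ] [Fintype σ] [Fact p.Prime] [CharP L p] in
/-- **END FORM ⇒ MONOMIAL CASE.** The cleaning of `X^β·V + Q` (`V` unit, `Q ∈ S_q`, `β` not `q`-divisible) is
`X^β·V'` with `V'` a unit: the terminal MONOMIAL CASE of [HP24] §3 for the `h = 0` flag (for `E ≠ ∅`). (Sources:
HauserPerlega2024, §3 p. 775 (monomial case).) -/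
theorem isMonomialCase_cleanSeries_of_inEndForm {q : ℕ} {G : MvPowerSeries σ L} {β : σ →₀ ℕ}
    (h : InEndForm q G β) (hβ : ¬ ∀ i, q ∣ β i) {E : Finset σ} (hE : E ≠ ∅) :
    IsMonomialCase q E (cleanSeries q G) := by
  classical
  obtain ⟨V, Q, hG, hV, hQ⟩ := h
  set P := MvPowerSeries.monomial β (1 : L) * V with hP
  have hclean : cleanSeries q G = cleanSeries q P := by
    rw [hG, cleanSeries_add', hQ.cleanSeries_eq_zero, add_zero]
  have hPd : ∀ d, ¬ β ≤ d → MvPowerSeries.coeff d P = 0 := fun d hd => by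
    rw [hP, MvPowerSeries.coeff_monomial_mul, if_neg hd]
  refine ⟨β, divMonomial β (cleanSeries q P), ?_, ?_, hβ, fun h => absurd h hE⟩
  · rw [hclean]
    refine MvPowerSeries.ext fun d => ?_
    rw [MvPowerSeries.coeff_monomial_mul, one_mul, coeff_divMonomial_eq]
    by_cases hd : β ≤ d
    · rw [if_pos hd, tsub_add_cancel_of_le hd]
    · rw [if_neg hd, coeff_cleanSeries]
      split_ifs
      · rfl
      · exact hPd d hd
  · rw [← MvPowerSeries.coeff_zero_eq_constantCoeff_apply, coeff_divMonomial_eq, zero_add, coeff_cleanSeries,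
      if_neg hβ, hP, MvPowerSeries.coeff_monomial_mul, if_pos le_rfl, tsub_self, one_mul,
      MvPowerSeries.coeff_zero_eq_constantCoeff_apply]
    exact hV

omit [DecidableEq σ] [Fintype σ] [Fact p.Prime] [CharP L p] in
/-- **END FORM ⇒ the monomial `X^β` divides the cleaning.** [folklore] -/
theorem le_of_coeff_cleanSeries_ne_zero_of_inEndForm {q : ℕ} {G : MvPowerSeries σ L} {β : σ →₀ ℕ}
    (h : InEndForm q G β) {d : σ →₀ ℕ} (hd : MvPowerSeries.coeff d (cleanSeries q G) ≠ 0) : β ≤ d := by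
  classical
  obtain ⟨V, Q, hG, -, hQ⟩ := h
  rw [hG, cleanSeries_add', hQ.cleanSeries_eq_zero, add_zero, coeff_cleanSeries] at hd
  split_ifs at hd with h
  · exact absurd rfl hd
  · by_contra hle
    rw [MvPowerSeries.coeff_monomial_mul, if_neg hle] at hd
    exact hd rfl

omit [DecidableEq σ] [Fintype σ] [Fact p.Prime] [CharP L p] in
/-- Curve form survives the cleaning (the removed part lies in `S_q`). [folklore] -/
theorem InCurveForm.of_cleanSeries {q : ℕ} {G : MvPowerSeries σ L} {m n : σ} {a b : ℕ}
    (h : InCurveForm q G m n a b) : InCurveForm q (cleanSeries q G) m n a b := by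
  obtain ⟨W, U, Q, hG, hU, hW0, hWn, hQ⟩ := h
  refine ⟨W, U, Q - (G - cleanSeries q G), ?_, hU, hW0, hWn, hQ.sub (isQPow_sub_cleanSeries q G)⟩
  linear_combination hG

end Trap

end Summit.ResolutionOfSingularities.ResolutionOfSingularities.Theorems.CurveTrap
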